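import Summits.AtomisticToContinuum.BoseEinsteinCondensation.Theses.BECCellInformation
import Literature.MathematicalPhysics.QuantumManyBody.BosonicFloorSymmetrisation
import Literature.MathematicalPhysics.QuantumManyBody.LiebYngvasonCellMethod

/-!
# Route `BECCellInformation` — support item `NonnegNearMinimiser` (stmt-AtomisticToContinuum-13445)

Closes stmt-AtomisticToContinuum-13445 (exact signature of
`Summit.AtomisticToContinuum.BoseEinsteinCondensation.Theses.BECCellInformation.NonnegNearMinimiser`):
for every pair-potential profile `v : ℝ → ℝ≥0∞` (no measurability needed), every `N`, `L` with
`E₀(N, L) = groundStateEnergy v N L ≠ ⊤` and every `δ > 0` there is a Dirichlet trial state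
`Ψ ∈ TrialState N L` with `energy v Ψ ≤ E₀(N, L) + δ` which is pointwise non-negative,
`Ψ(X) = |Ψ(X)|` for all `X`.

## Proof (diamagnetic smoothing)

Pick `Φ ∈ TrialState N L` with `energy v Φ < E₀ + δ` (definition of the infimum; `E₀ ≠ ⊤`). For
`ε > 0` the regularised modulus `g_ε = √(ε² + |Φ|²) − ε` of
`Literature/…/BosonicFloorSymmetrisation.lean` (used with the one-member family `fun _ : Unit => Φ`)
is `C¹`, vanishes where `Φ` does (so off the open box), is Bose-symmetric, and satisfies pointwise
`|∇g_ε|² ≤ |∇Φ|²` (convexity inequality for gradients, [Lieb–Loss, *Analysis*, Thm. 7.8 / 6.17])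
and `g_ε² ≤ |Φ|²`. Hence, with `A_ε = ∫ g_ε² ≤ 1`, the normalised state `g_ε / √A_ε` has energy
`≤ energy(Φ) / A_ε` (only `lintegral_mono` and `lintegral_const_mul'` are used, so `v` need not be
measurable). Along `ε = 1/(n+1) → 0`, `A_ε → ∫ |Φ|² = 1` by dominated convergence, so
`energy(Φ) · A_ε⁻¹ → energy(Φ) < E₀ + δ`; choose `n` with `energy(Φ) · A_ε⁻¹ < E₀ + δ` and `A_ε > 0`.
Degenerate regimes need no case split (`N = 0`: `Config 0` is a point and the argument is
unchanged; `L ≤ 0 < N`: `TrialState` is empty, `E₀ = ⊤`, excluded by hypothesis).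

## References

* [LiebLoss2001] E. H. Lieb, M. Loss, *Analysis*, 2nd ed., AMS 2001, Thm. 6.17 (derivative of the
  absolute value) and Thm. 7.8 (convexity inequality for gradients).
* [LSSY2005] E. H. Lieb, R. Seiringer, J. P. Solovej, J. Yngvason, *The Mathematics of the Bose Gas
  and its Condensation*, Birkhäuser 2005, Ch. 2 (non-negative ground states / minimisers).
-/

noncomputable section

namespace Summit.AtomisticToContinuum.BoseEinsteinCondensation.Theorems

open MeasureTheory Filter Topology
open scoped ENNReal NNReal
open Literature.MathematicalPhysics.QuantumManyBody.BoseGas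

namespace NonnegNearMinimiser

variable {N : ℕ} {φ : Config N → ℂ} {ε : ℝ}

/-! ### The regularised modulus `√(ε² + |φ|²) − ε` of a single wave function -/

/-- `g_ε = √(ε² + |φ|²) − ε` (complexified) is `C¹` for `C¹` `φ` and `ε > 0`. [folklore] -/
theorem contDiff_sqrtAbs (hφ : ContDiff ℝ 1 φ) (hε : 0 < ε) :
    ContDiff ℝ 1 (fun Y : Config N => ((Real.sqrt (ε ^ 2 + ‖φ Y‖ ^ 2) - ε : ℝ) : ℂ)) := by
  have h := contDiff_sqrtReg (fun _ : Unit => φ) (fun _ => hφ) hε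
  simp only [Finset.univ_unique, Finset.sum_singleton] at h
  exact Complex.ofRealCLM.contDiff.comp h

/-- **Diamagnetic inequality (regularised, pointwise)**: `|∇g_ε|²(X) ≤ |∇φ|²(X)` coordinatewise,
hence for the kinetic density. [cite: LiebLoss2001, Thm. 7.8] -/
theorem kineticDensity_sqrtAbs_le (hφ : ContDiff ℝ 1 φ) (hε : 0 < ε) (X : Config N) :
    kineticDensity (fun Y : Config N => ((Real.sqrt (ε ^ 2 + ‖φ Y‖ ^ 2) - ε : ℝ) : ℂ)) X ≤
      kineticDensity φ X := by
  have hd : ∀ _j : Unit, DifferentiableAt ℝ φ X := fun _ => (hφ.differentiable one_ne_zero) X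
  unfold kineticDensity
  refine Finset.sum_le_sum fun i _ => Finset.sum_le_sum fun k _ => ?_
  have h := nnnorm_fderiv_ofReal_sqrtReg_sq_le (fun _ : Unit => φ) hd hε
    (Pi.single i (EuclideanSpace.single k (1 : ℝ)))
  simp only [Finset.univ_unique, Finset.sum_singleton] at h
  exact h

/-- `‖g_ε(X)‖₊² ≤ ‖φ(X)‖₊²` (from `g_ε² ≤ |φ|²`). [folklore] -/
theorem nnnorm_sqrtAbs_sq_le (φ : Config N → ℂ) (hε : 0 < ε) (X : Config N) :
    ((‖((Real.sqrt (ε ^ 2 + ‖φ X‖ ^ 2) - ε : ℝ) : ℂ)‖₊ : ℝ≥0∞)) ^ 2 ≤ ((‖φ X‖₊ : ℝ≥0∞)) ^ 2 := by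
  have h := nnnorm_ofReal_sqrtReg_sq_le (fun _ : Unit => φ) X hε
  simp only [Finset.univ_unique, Finset.sum_singleton] at h
  exact h

/-- Removing the regularisation pointwise: `‖g_{1/(n+1)}(X)‖₊² → ‖φ(X)‖₊²`. [folklore] -/
theorem tendsto_nnnorm_sqrtAbs_sq (φ : Config N → ℂ) (X : Config N) :
    Tendsto (fun n : ℕ => ((‖((Real.sqrt ((1 / ((n : ℝ) + 1)) ^ 2 + ‖φ X‖ ^ 2) -
        1 / ((n : ℝ) + 1) : ℝ) : ℂ)‖₊ : ℝ≥0∞)) ^ 2) atTop (𝓝 (((‖φ X‖₊ : ℝ≥0∞)) ^ 2)) := by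
  have h := ENNReal.tendsto_ofReal (tendsto_sqrtReg_sq (sq_nonneg ‖φ X‖))
  rw [← coe_nnnorm_pow_two_eq_ofReal] at h
  refine h.congr fun n => ?_
  rw [Complex.nnnorm_real, coe_nnnorm_pow_two_eq_ofReal, Real.norm_eq_abs, sq_abs]

/-- `g_ε(X) ≥ 0` as a real number. [folklore] -/
theorem sqrtAbs_nonneg (φ : Config N → ℂ) (hε : 0 ≤ ε) (X : Config N) :
    0 ≤ Real.sqrt (ε ^ 2 + ‖φ X‖ ^ 2) - ε :=
  sqrtReg_nonneg hε (sq_nonneg _)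

/-! ### Non-negative near-minimisers -/

/-- **Diamagnetic smoothing of a trial state.** For every Dirichlet trial state `Φ` and every
strict energy bound `energy v Φ < E` there is a pointwise non-negative trial state `Ψ = |Ψ|` with
`energy v Ψ ≤ E`: normalise `g_ε = √(ε² + |Φ|²) − ε` and let `ε = 1/(n+1) → 0`.
[cite: LiebLoss2001, Thm. 7.8] -/
theorem exists_nonneg_energy_le {L : ℝ} (v : ℝ → ℝ≥0∞) (Φ : TrialState N L) {E : ℝ≥0∞}
    (hE : energy v Φ < E) :
    ∃ Ψ : TrialState N L, energy v Ψ ≤ E ∧ ∀ X, Ψ.ψ X = ((‖Ψ.ψ X‖ : ℝ) : ℂ) := by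
  have hφ : ContDiff ℝ 1 Φ.ψ := Φ.contDiff
  -- the regularised moduli along `ε = 1/(n+1)` and their masses
  set g : ℕ → Config N → ℂ := fun n Y =>
    ((Real.sqrt ((1 / ((n : ℝ) + 1)) ^ 2 + ‖Φ.ψ Y‖ ^ 2) - 1 / ((n : ℝ) + 1) : ℝ) : ℂ) with hg_def
  set A : ℕ → ℝ≥0∞ := fun n => ∫⁻ Y, ((‖g n Y‖₊ : ℝ≥0∞)) ^ 2 with hA_def
  have hεpos : ∀ n : ℕ, (0 : ℝ) < 1 / ((n : ℝ) + 1) := fun n => Nat.one_div_pos_of_nat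
  have hgC : ∀ n, ContDiff ℝ 1 (g n) := fun n => contDiff_sqrtAbs hφ (hεpos n)
  -- `A n → ∫ |Φ|² = 1` (dominated convergence)
  have hA : Tendsto A atTop (𝓝 1) := by
    rw [← Φ.norm_eq]
    refine tendsto_lintegral_of_dominated_convergence (fun Y => ((‖Φ.ψ Y‖₊ : ℝ≥0∞)) ^ 2)
      (fun n => measurable_normSq (hgC n).continuous)
      (fun n => ae_of_all _ fun Y => nnnorm_sqrtAbs_sq_le Φ.ψ (hεpos n) Y) ?_
      (ae_of_all _ fun Y => tendsto_nnnorm_sqrtAbs_sq Φ.ψ Y)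
    rw [Φ.norm_eq]
    exact ENNReal.one_ne_top
  have hinv : Tendsto (fun n => (A n)⁻¹) atTop (𝓝 1) := by
    have h := hA.inv
    rwa [inv_one] at h
  have hmul : Tendsto (fun n => energy v Φ * (A n)⁻¹) atTop (𝓝 (energy v Φ)) := by
    have h := ENNReal.Tendsto.const_mul (a := energy v Φ) hinv (Or.inl one_ne_zero)
    rwa [mul_one] at h
  obtain ⟨n, hn, hn0⟩ :=
    ((hmul.eventually_lt_const hE).and (hA.eventually_const_lt zero_lt_one)).exists
  -- normalise `g n`
  set m : ℝ≥0∞ := A n with hm_def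
  have hm0 : m ≠ 0 := hn0.ne'
  have hm1 : m ≤ 1 := by
    rw [← Φ.norm_eq]
    exact lintegral_mono fun Y => nnnorm_sqrtAbs_sq_le Φ.ψ (hεpos n) Y
  have hmtop : m ≠ ⊤ := ne_top_of_le_ne_top ENNReal.one_ne_top hm1
  have hmpos : 0 < m.toReal := ENNReal.toReal_pos hm0 hmtop
  set c : ℝ := Real.sqrt (m.toReal)⁻¹ with hc_def
  have hc0 : 0 ≤ c := Real.sqrt_nonneg _
  have hc2 : ENNReal.ofReal (c ^ 2) = m⁻¹ := by
    rw [hc_def, Real.sq_sqrt (inv_nonneg.2 hmpos.le), ENNReal.ofReal_inv_of_pos hmpos,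
      ENNReal.ofReal_toReal hmtop]
  have hg0 : ∀ Y, 0 ≤ Real.sqrt ((1 / ((n : ℝ) + 1)) ^ 2 + ‖Φ.ψ Y‖ ^ 2) - 1 / ((n : ℝ) + 1) :=
    fun Y => sqrtAbs_nonneg Φ.ψ (hεpos n).le Y
  let Ψ : TrialState N L :=
    { ψ := fun Y => (c : ℂ) * g n Y
      contDiff := contDiff_const.mul (hgC n)
      eq_zero := fun Y hY => by
        have h0 : Φ.ψ Y = 0 := Φ.eq_zero Y hY
        simp only [hg_def, h0, norm_zero, ne_eq, OfNat.ofNat_ne_zero, not_false_eq_true,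
          zero_pow, add_zero]
        rw [Real.sqrt_sq (hεpos n).le, sub_self, Complex.ofReal_zero, mul_zero]
      symm := fun σ Y => by
        show (c : ℂ) * g n (Y ∘ σ) = c * g n Y
        simp only [hg_def, Φ.symm σ Y]
      norm_eq := by
        simp only [ennorm_real_mul_sq c hc0]
        rw [lintegral_const_mul' _ _ ENNReal.ofReal_ne_top, hc2]
        exact ENNReal.inv_mul_cancel hm0 hmtop }
  refine ⟨Ψ, ?_, fun Y => ?_⟩
  · -- `energy Ψ = m⁻¹ ∫ (|∇g|² + V g²) ≤ m⁻¹ energy Φ < E`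
    have hEΨ : energy v Ψ ≤ m⁻¹ * energy v Φ := by
      unfold energy
      rw [← hc2, ← lintegral_const_mul' _ _ ENNReal.ofReal_ne_top]
      refine lintegral_mono fun Y => ?_
      change kineticDensity (fun Y => (c : ℂ) * g n Y) Y + interaction v Y *
        ((‖(c : ℂ) * g n Y‖₊ : ℝ≥0∞)) ^ 2 ≤ _
      rw [kineticDensity_const_mul (hgC n) c hc0, ennorm_real_mul_sq c hc0, mul_add,
        mul_left_comm]
      refine add_le_add (mul_le_mul_right (kineticDensity_sqrtAbs_le hφ (hεpos n) Y) _)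
        (mul_le_mul_right (mul_le_mul_right (nnnorm_sqrtAbs_sq_le Φ.ψ (hεpos n) Y) _) _)
    calc energy v Ψ ≤ m⁻¹ * energy v Φ := hEΨ
      _ = energy v Φ * m⁻¹ := mul_comm _ _
      _ ≤ E := hn.le
  · -- non-negativity: `c · g ≥ 0` is real
    show (c : ℂ) * g n Y = ((‖(c : ℂ) * g n Y‖ : ℝ) : ℂ)
    simp only [hg_def]
    rw [← Complex.ofReal_mul, Complex.norm_real, Real.norm_of_nonneg (mul_nonneg hc0 (hg0 Y))]

end NonnegNearMinimiser

/-- **Non-negative near-minimisers exist** (item `NonnegNearMinimiser` of route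
`BECCellInformation`, stmt-AtomisticToContinuum-13445): for all `v`, `N`, `L` with
`groundStateEnergy v N L ≠ ⊤` and every `δ > 0` there is `Ψ ∈ TrialState N L` with
`energy v Ψ ≤ groundStateEnergy v N L + δ` and `Ψ = |Ψ|` pointwise. Proof: a trial state with
`energy < E₀ + δ` exists by definition of the infimum, and
`NonnegNearMinimiser.exists_nonneg_energy_le` smooths it diamagnetically.
[cite: LiebLoss2001, Thm. 7.8] -/
theorem nonnegNearMinimiser_proof :
    Summit.AtomisticToContinuum.BoseEinsteinCondensation.Theses.BECCellInformation.NonnegNearMinimiser := by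
  intro v N L hE δ hδ
  have hlt : groundStateEnergy v N L < groundStateEnergy v N L + δ :=
    ENNReal.lt_add_right hE hδ.ne'
  obtain ⟨Φ, hΦ⟩ := iInf_lt_iff.1 hlt
  exact NonnegNearMinimiser.exists_nonneg_energy_le v Φ hΦ

end Summit.AtomisticToContinuum.BoseEinsteinCondensation.Theorems

end
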